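import Mathlib
import Literature.Geometry.Symplectic.JHolomorphicMap
import Literature.Analysis.FunctionSpaces.EquicontinuousExtraction
import Summits.SmoothPoincare4.SmoothPoincare4.Theorems.SullivanDualTameOrBrodyR4BlowUp

/-!
# Stub `stub_compactnessLoc` of line `Sketch` for crux `TameOrBrodyR4` (stmt-SmoothPoincare4-7826)

Route SullivanDual; registered worker stub of the line skeleton `Cruxes/TameOrBrodyR4/Lines/Sketch`.

`C¹_loc`-compactness of entire `J`-holomorphic maps under local bounds: for a `C^∞` almost
complex structure `J` on `ℝ⁴ = EuclideanSpace ℝ (Fin 4)`, entire `C^∞` flat-`J`-holomorphic maps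
`u n : ℂ → ℝ⁴` whose values and first derivatives are bounded on every disc `‖z‖ ≤ ρ` uniformly in
`n` have a subsequence converging locally uniformly on `ℂ`, together with the first derivatives,
to an entire `C^∞` flat-`J`-holomorphic limit. This generalises the landed
`BlowUp.compactness_C1` (fixed compact target set, gradient bound `2` on growing discs) to
radius-dependent bounds. Proof:

* locally uniform bounds on ALL derivatives, uniformly in `n`
  (`CompactnessLoc.norm_iteratedFDeriv_le`): at a centre `z`, `‖z‖ ≤ ρ`, rescale by
  `δ = (max 1 M(ρ+1))⁻¹`, so that `η ↦ u n (z + δ η)` maps the closed unit disc into the ball of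
  radius `C(ρ + 1)` with gradient `≤ 1 ≤ 2`; the landed a-priori estimate
  `BlowUp.apriori_estimate` bounds its `k`-th derivative at `0`, and undoing the dilation costs
  the factor `δ⁻ᵏ` (`CompactnessLoc.pow_mul_norm_iteratedFDeriv_le`);
* Arzelà–Ascoli: the family is equicontinuous (mean value inequality on unit balls,
  `CompactnessLoc.equicontinuous_of_fderiv_bound`) and pointwise bounded, so the tree's sequential
  Arzelà–Ascoli theorem `exists_strictMono_tendstoLocallyUniformlyOn_of_equicontinuousOn`
  (`Literature/Analysis/FunctionSpaces/EquicontinuousExtraction.lean`) extracts a locally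
  uniformly convergent subsequence;
* the landed `stub_smoothLimit` makes the limit `C^∞` with locally uniform convergence of the
  first derivatives, and the equation `du (i ζ) = J(u) (du ζ)` passes to the limit pointwise
  (verbatim as in `BlowUp.compactness_C1`).

References: folklore (Arzelà–Ascoli; elliptic bootstrapping under a `C¹` bound,
D. McDuff, D. Salamon, *J-holomorphic curves and symplectic topology*, 2nd ed. (2012), Thm B.4.2).
-/

-- the registered namespace `Summit.SmoothPoincare4.SmoothPoincare4.…` repeats a component
set_option linter.dupNamespace false

noncomputable section

open scoped ContDiff Topology
open Filter Set Metric Literature.Geometry.Symplectic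

namespace Summit.SmoothPoincare4.SmoothPoincare4.Cruxes.TameOrBrodyR4.Sketch

/-- Local notation for the model space `ℝ⁴ = EuclideanSpace ℝ (Fin 4)`. -/
local notation "E4" => EuclideanSpace ℝ (Fin 4)

namespace CompactnessLoc

-- The two dilation lemmas below are adapted from
-- Theorems/SullivanDualWitnessChargeHelperDerivBoundsLocal.lean
-- (`derivBoundsLocal_pow_mul_norm_le`, `derivBoundsLocal_pow_mul_norm_iteratedFDeriv_le`).

/-- Undoing a dilation by `ρ > 0` in every slot of a continuous `k`-multilinear map costs a factor
`ρ⁻¹` per slot: `ρᵏ ‖T‖ ≤ ‖T ∘ (e, …, e)‖` when `e ζ = ρ • ζ`. -/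
theorem pow_mul_norm_le {k : ℕ} (T : ContinuousMultilinearMap ℝ (fun _ : Fin k => ℂ) E4)
    (e : ℂ →L[ℝ] ℂ) {ρ : ℝ} (hρ : 0 < ρ) (he : ∀ ζ : ℂ, e ζ = ρ • ζ) :
    ρ ^ k * ‖T‖ ≤ ‖T.compContinuousLinearMap fun _ => e‖ := by
  rw [← le_div_iff₀' (pow_pos hρ k)]
  refine ContinuousMultilinearMap.opNorm_le_bound (by positivity) fun m => ?_
  have hm : T m = (T.compContinuousLinearMap fun _ => e) fun i => ρ⁻¹ • m i := by
    rw [ContinuousMultilinearMap.compContinuousLinearMap_apply]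
    congr 1
    funext i
    rw [he, smul_smul, mul_inv_cancel₀ hρ.ne', one_smul]
  have hprod : ∏ i : Fin k, ‖ρ⁻¹ • m i‖ = ρ⁻¹ ^ k * ∏ i, ‖m i‖ := by
    simp only [norm_smul, Real.norm_eq_abs, abs_inv, abs_of_pos hρ, Finset.prod_mul_distrib,
      Finset.prod_const, Finset.card_univ, Fintype.card_fin]
  calc ‖T m‖ = ‖(T.compContinuousLinearMap fun _ => e) fun i => ρ⁻¹ • m i‖ := by rw [hm]
    _ ≤ ‖T.compContinuousLinearMap fun _ => e‖ * ∏ i, ‖ρ⁻¹ • m i‖ :=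
        ContinuousMultilinearMap.le_opNorm _ _
    _ = ‖T.compContinuousLinearMap fun _ => e‖ / ρ ^ k * ∏ i, ‖m i‖ := by
        rw [hprod, inv_pow, div_eq_mul_inv, mul_assoc]

/-- Rescaling by `ρ > 0` at `z` multiplies the norm of the `k`-th derivative by at least `ρᵏ`:
`ρᵏ ‖Dᵏ v(z)‖ ≤ ‖Dᵏ (v(z + ρ ·))(0)‖` (no smoothness assumption is needed, the dilation being a
continuous linear equivalence). -/
theorem pow_mul_norm_iteratedFDeriv_le (v : ℂ → E4) (z : ℂ) {ρ : ℝ} (hρ : 0 < ρ) (k : ℕ) :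
    ρ ^ k * ‖iteratedFDeriv ℝ k v z‖ ≤
      ‖iteratedFDeriv ℝ k (fun ζ : ℂ => v (z + ρ • ζ)) 0‖ := by
  obtain ⟨e, he⟩ : ∃ e : ℂ ≃L[ℝ] ℂ, ∀ ζ : ℂ, e ζ = ρ • ζ :=
    ⟨ContinuousLinearEquiv.equivOfInverse (ρ • ContinuousLinearMap.id ℝ ℂ)
      (ρ⁻¹ • ContinuousLinearMap.id ℝ ℂ) (fun ζ => by simp [hρ.ne'])
      (fun ζ => by simp [hρ.ne']), fun ζ => rfl⟩
  have h1 : (fun ζ : ℂ => v (z + ρ • ζ)) = (fun w : ℂ => v (z + w)) ∘ e := by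
    funext ζ
    simp [he]
  have h2 := e.iteratedFDerivWithin_comp_right (fun w : ℂ => v (z + w)) uniqueDiffOn_univ
    (x := 0) (mem_univ _) k
  simp only [preimage_univ, iteratedFDerivWithin_univ, map_zero] at h2
  rw [h1, h2, iteratedFDeriv_comp_add_left, add_zero]
  exact pow_mul_norm_le _ _ hρ he

/-- **Locally uniform bounds on all derivatives, uniformly in `n`.** For entire `C^∞`
flat-`J`-holomorphic maps with values and gradients bounded on every disc uniformly in `n`, every
`k`-th derivative is bounded on every disc uniformly in `n` (rescale at each centre to gradient
`≤ 1` on the unit disc, apply the a-priori estimate `BlowUp.apriori_estimate`, undo the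
dilation). -/
theorem norm_iteratedFDeriv_le (J : E4 → E4 →L[ℝ] E4) (hJs : ContDiff ℝ ∞ J)
    (hJ2 : ∀ x v, J x (J x v) = -v) (u : ℕ → ℂ → E4) (hu : ∀ n, ContDiff ℝ ∞ (u n))
    (huJ : ∀ n, IsJHolomorphicFlat J (u n))
    (hK : ∀ ρ : ℝ, ∃ C : ℝ, ∀ n (z : ℂ), ‖z‖ ≤ ρ → ‖u n z‖ ≤ C)
    (hD : ∀ ρ : ℝ, ∃ M : ℝ, ∀ n (z : ℂ), ‖z‖ ≤ ρ → ‖fderiv ℝ (u n) z‖ ≤ M) (k : ℕ) (ρ : ℝ) :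
    ∃ C : ℝ, ∀ n, ∀ z ∈ closedBall (0 : ℂ) ρ, ‖iteratedFDeriv ℝ k (u n) z‖ ≤ C := by
  obtain ⟨C₀, hC₀⟩ := hK (ρ + 1)
  obtain ⟨M₀, hM₀⟩ := hD (ρ + 1)
  obtain ⟨C, hC⟩ := BlowUp.apriori_estimate J hJs hJ2 C₀ k
  -- the scale `δ = (max 1 M₀)⁻¹ ∈ (0, 1]`
  set M : ℝ := max 1 M₀ with hM
  have hM1 : 1 ≤ M := le_max_left _ _
  have hMpos : 0 < M := one_pos.trans_le hM1
  set δ : ℝ := M⁻¹ with hδ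
  have hδpos : 0 < δ := inv_pos.mpr hMpos
  have hδ1 : δ ≤ 1 := inv_le_one_of_one_le₀ hM1
  refine ⟨C / δ ^ k, fun n z hz => ?_⟩
  have hzρ : ‖z‖ ≤ ρ := mem_closedBall_zero_iff.mp hz
  -- the rescaled closed unit disc lies in the disc of radius `ρ + 1`
  have hmem : ∀ η : ℂ, ‖η‖ ≤ 1 → ‖z + δ • η‖ ≤ ρ + 1 := fun η hη =>
    calc ‖z + δ • η‖ ≤ ‖z‖ + δ * ‖η‖ := Zalcman.norm_affine_le z η hδpos.le
      _ ≤ ρ + 1 * 1 := add_le_add hzρ (mul_le_mul hδ1 hη (norm_nonneg _) zero_le_one)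
      _ = ρ + 1 := by ring
  have hdiff : Differentiable ℝ (u n) := (hu n).differentiable (by simp)
  have key := hC (fun η => u n (z + δ • η)) (Zalcman.contDiff_comp_affine (hu n) z δ)
    (Zalcman.isJHolomorphicFlat_comp_affine hdiff (huJ n) z δ)
    (fun η hη => hC₀ n _ (hmem η hη))
    (fun η hη => by
      rw [Zalcman.norm_fderiv_comp_affine hdiff z hδpos.le]
      calc δ * ‖fderiv ℝ (u n) (z + δ • η)‖
          ≤ δ * M₀ := mul_le_mul_of_nonneg_left (hM₀ n _ (hmem η hη)) hδpos.le
        _ ≤ δ * M := mul_le_mul_of_nonneg_left (le_max_right _ _) hδpos.le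
        _ = 1 := inv_mul_cancel₀ hMpos.ne'
        _ ≤ 2 := one_le_two)
  rw [le_div_iff₀ (pow_pos hδpos k), mul_comm]
  exact (pow_mul_norm_iteratedFDeriv_le (u n) z hδpos k).trans key

/-- **Equicontinuity from local gradient bounds.** `C^∞` maps `u n : ℂ → ℝ⁴` whose gradients are
bounded on every disc uniformly in `n` form an equicontinuous family: on the unit ball around `x₀`
they are `M(‖x₀‖ + 1)`-Lipschitz (mean value inequality on a convex set). -/
theorem equicontinuous_of_fderiv_bound (u : ℕ → ℂ → E4) (hu : ∀ n, ContDiff ℝ ∞ (u n))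
    (hD : ∀ ρ : ℝ, ∃ M : ℝ, ∀ n (z : ℂ), ‖z‖ ≤ ρ → ‖fderiv ℝ (u n) z‖ ≤ M) :
    Equicontinuous u := by
  intro x₀
  obtain ⟨M, hM⟩ := hD (‖x₀‖ + 1)
  refine Metric.equicontinuousAt_of_continuity_modulus (fun x => M * dist x x₀) ?_ u ?_
  · have h : Tendsto (fun x : ℂ => M * dist x x₀) (𝓝 x₀) (𝓝 (M * dist x₀ x₀)) :=
      ((continuous_id.dist continuous_const).tendsto x₀).const_mul M
    rwa [dist_self, mul_zero] at h
  · filter_upwards [ball_mem_nhds x₀ one_pos] with x hx n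
    rw [dist_comm, dist_eq_norm, dist_eq_norm]
    exact (convex_ball x₀ 1).norm_image_sub_le_of_norm_fderiv_le (𝕜 := ℝ)
      (fun y _ => ((hu n).differentiable (by simp)) y)
      (fun y hy => hM n y (norm_le_norm_add_const_of_dist_le (mem_ball.mp hy).le))
      (mem_ball_self one_pos) hx

end CompactnessLoc

open Literature.Analysis.FunctionSpaces in
/-- **Stub (classical): `C¹_loc`-compactness of entire `J`-holomorphic maps under local bounds.**
Entire `C^∞` flat-`J`-holomorphic `u n` with values and first derivatives bounded on every disc
uniformly in `n` have a subsequence converging locally uniformly on `ℂ`, with first derivatives,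
to an entire `C^∞` flat-`J`-holomorphic limit (rescaled a-priori estimate
`BlowUp.apriori_estimate` at every centre ⇒ locally uniform bounds on all derivatives;
Arzelà–Ascoli; `stub_smoothLimit`; the equation passes to the limit pointwise, cf.
`BlowUp.compactness_C1`). -/
theorem stub_compactnessLoc (J : E4 → E4 →L[ℝ] E4) (hJs : ContDiff ℝ ∞ J)
    (hJ2 : ∀ x v, J x (J x v) = -v) (u : ℕ → ℂ → E4) (hu : ∀ n, ContDiff ℝ ∞ (u n))
    (huJ : ∀ n, IsJHolomorphicFlat J (u n))
    (hK : ∀ ρ : ℝ, ∃ C : ℝ, ∀ n (z : ℂ), ‖z‖ ≤ ρ → ‖u n z‖ ≤ C)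
    (hD : ∀ ρ : ℝ, ∃ M : ℝ, ∀ n (z : ℂ), ‖z‖ ≤ ρ → ‖fderiv ℝ (u n) z‖ ≤ M) :
    ∃ (v : ℂ → E4) (φ : ℕ → ℕ), StrictMono φ ∧ ContDiff ℝ ∞ v ∧ IsJHolomorphicFlat J v ∧
      TendstoLocallyUniformly (fun k => u (φ k)) v atTop ∧
      TendstoLocallyUniformly (fun k => fderiv ℝ (u (φ k))) (fderiv ℝ v) atTop := by
  -- Arzelà–Ascoli: a locally uniformly convergent subsequence
  have heq : EquicontinuousOn u univ :=
    (CompactnessLoc.equicontinuous_of_fderiv_bound u hu hD).equicontinuousOn univ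
  have hb : ∀ x ∈ (univ : Set ℂ), ∃ (y₀ : E4) (B : ℝ), ∀ n, dist (u n x) y₀ ≤ B := by
    intro x _
    obtain ⟨C, hC⟩ := hK ‖x‖
    exact ⟨0, C, fun n => by rw [dist_zero_right]; exact hC n x le_rfl⟩
  obtain ⟨v, φ, hφ, -, hloc⟩ :=
    exists_strictMono_tendstoLocallyUniformlyOn_of_equicontinuousOn isOpen_univ heq hb
  rw [tendstoLocallyUniformlyOn_univ] at hloc
  -- locally uniform bounds on all derivatives along the subsequence; smooth limit
  have hb' : ∀ (m : ℕ) (ρ : ℝ), ∃ C : ℝ, ∀ k, ∀ z ∈ Metric.closedBall (0 : ℂ) ρ,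
      ‖iteratedFDeriv ℝ m (u (φ k)) z‖ ≤ C := fun m ρ => by
    obtain ⟨C, hC⟩ := CompactnessLoc.norm_iteratedFDeriv_le J hJs hJ2 u hu huJ hK hD m ρ
    exact ⟨C, fun k z hz => hC (φ k) z hz⟩
  obtain ⟨hv, hd⟩ := stub_smoothLimit (fun k => u (φ k)) v (fun k => hu _) hb' hloc
  refine ⟨v, φ, hφ, hv, ?_, hloc, hd⟩
  -- the equation passes to the limit pointwise (as in `BlowUp.compactness_C1`)
  intro z ζ
  have hev : Continuous fun p : (E4 →L[ℝ] E4) × E4 => p.1 p.2 :=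
    isBoundedBilinearMap_apply.continuous
  have hTz : Tendsto (fun k => fderiv ℝ (u (φ k)) z) atTop (𝓝 (fderiv ℝ v z)) :=
    hd.tendstoLocallyUniformlyOn.tendsto_at (mem_univ z)
  have huz : Tendsto (fun k => u (φ k) z) atTop (𝓝 (v z)) :=
    hloc.tendstoLocallyUniformlyOn.tendsto_at (mem_univ z)
  have h1 : Tendsto (fun k => fderiv ℝ (u (φ k)) z (Complex.I * ζ)) atTop
      (𝓝 (fderiv ℝ v z (Complex.I * ζ))) :=
    ((continuous_id.clm_apply continuous_const).tendsto (fderiv ℝ v z)).comp hTz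
  have h2 : Tendsto (fun k => J (u (φ k) z) (fderiv ℝ (u (φ k)) z ζ)) atTop
      (𝓝 (J (v z) (fderiv ℝ v z ζ))) := by
    have hJt : Tendsto (fun k => J (u (φ k) z)) atTop (𝓝 (J (v z))) :=
      (hJs.continuous.tendsto (v z)).comp huz
    have hdζ : Tendsto (fun k => fderiv ℝ (u (φ k)) z ζ) atTop (𝓝 (fderiv ℝ v z ζ)) :=
      ((continuous_id.clm_apply continuous_const).tendsto (fderiv ℝ v z)).comp hTz
    exact (hev.tendsto (J (v z), fderiv ℝ v z ζ)).comp (hJt.prodMk_nhds hdζ)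
  have heq' : (fun k => fderiv ℝ (u (φ k)) z (Complex.I * ζ)) =
      fun k => J (u (φ k) z) (fderiv ℝ (u (φ k)) z ζ) := funext fun k => huJ (φ k) z ζ
  rw [heq'] at h1
  exact tendsto_nhds_unique h1 h2

end Summit.SmoothPoincare4.SmoothPoincare4.Cruxes.TameOrBrodyR4.Sketch
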